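import Literature.Analysis.PDE.LoewnerNirenbergFacts
import HarnessLib

/-!
# The maximal solution of the Loewner–Nirenberg equation: proved steps of the printed proof

Sorry-free theorems towards the named fact `LoewnerNirenberg.exists_isMaximalSolution` (F1 of
`LoewnerNirenbergFacts.lean`: every domain `Ω ⊆ ℝⁿ`, `n ≥ 3`, with `ℝⁿ ∖ Ω̄ ≠ ∅` carries a
positive maximal solution of `Δu = ¼n(n-2)u^{(n+2)/(n-2)}`; González–Li–Nguyen 2018, Def. 4.1 and
the paragraph following it, after Loewner–Nirenberg 1974), following the printed proof
(González–Li–Nguyen 2018, Prop. 2.2, Lemma 3.1, Lemma 3.2, §4, specialised to `(f, Γ) = (σ₁, Γ₁)`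
and to classical `C²` solutions) in the tree's vocabulary (`IsSolution`, `IsSubsolution`,
`IsLargeSolution`, `loewnerNirenberg Ω = u_Ω`, `ballProfile`, `exteriorProfile`):

* **Prop. 2.2 (comparison principle), classical case** — `comparison`: on a bounded open `U` a
  `C²` subsolution lies below a `C²` supersolution `w ≥ 0` once `limsup (v - w) ≤ 0` at `∂U` (at
  an interior positive maximum of `v - w`, `Δ(v - w) ≤ 0 < f(v) - f(w)`, by
  `laplacian_nonpos_of_isLocalMax` and `nonlinearity_lt_nonlinearity` of the Facts file); whence
  `IsLargeSolution.ge_of_isSubsolution`, `IsLargeSolution.ge_of_isSolution` (a solution on an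
  open `Ω ⊇ Ū` lies below every large solution of `U`: "by the comparison principle, `u_j` is
  non-increasing", §4) and `IsLargeSolution.antitone_of_closure_subset`.
* **Lemma 3.1 (upper bound)** — `IsSubsolution.le_ballProfile`, `….le_rpow_of_closedBall_subset`,
  `….le_rpow_infDist`: `v ≤ u^{(in)}_{r,x}` on `B(x,r) ⋐ Ω`, so `v(x) ≤ (2/r)^{(n-2)/2}` and
  `v(x) ≤ (2/d(x))^{(n-2)/2}`, `d(x) = dist(x, ℝⁿ ∖ Ω)` (printed: `d^{(n-2)/2} v ≤ α`,
  `α = 2^{(n-2)/2}` here). Hence `bddAbove_valuesAt_of_isOpen` — the `sSup` defining `u_Ω` is a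
  genuine supremum — and UNCONDITIONALLY `IsSolution.le_loewnerNirenberg_of_isOpen`,
  `loewnerNirenberg_antitone_of_isOpen` ("if `Ω ⊂ Ω̃`, then `u_Ω ≥ u_Ω̃` in `Ω`"),
  `loewnerNirenberg_le_rpow_of_closedBall_subset`, `loewnerNirenberg_le_rpow_infDist`.
* **Lemma 3.2 (lower bound)** as used after Def. 4.1 ("`u_Ω > 0` … if `ℝⁿ ∖ Ω̄ ≠ ∅`") —
  `exteriorProfile_le_loewnerNirenberg_of_subset`, `loewnerNirenberg_pos_of_isOpen`: the
  positivity half of F1, UNCONDITIONALLY.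
* **Def. 4.1 (maximality)** — `isMaximalSolution_loewnerNirenberg_of_isSolution` (once `u_Ω`
  solves the equation it is the maximal solution), `exists_isMaximalSolution_iff` (F1 ⇔ "`u_Ω`
  solves the equation on every domain with `ℝⁿ ∖ Ω̄ ≠ ∅`"), `loewnerNirenberg_le_of_isLargeSolution`
  (`u_Ω ≤ u_j` on `Ω_j ⋐ Ω`), `eqOn_loewnerNirenberg_of_exhaustion` (if the large solutions
  `u_j` of an exhaustion converge pointwise to a solution `u`, then `u = u_Ω`): the printed
  construction `u_Ω = lim u_j`, closed modulo existence of the `u_j` and regularity of the limit.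

Deliberately NOT here (the non-elementary remainder of the printed proof; no Mathlib support yet):
Thm. 1.1 / Lemma 3.6 (the large solution of a smooth bounded domain, by Perron's method),
Thm. 3.5 (interior gradient estimates) and the passage to the limit in Def. 4.1 (a locally
bounded monotone limit of solutions is a `C²` solution: interior elliptic estimates). With them,
`exists_isMaximalSolution_iff` closes F1.

## References

* M. d. M. González, Y. Y. Li, L. Nguyen, *Existence and uniqueness to a fully nonlinear version
  of the Loewner–Nirenberg problem*, Commun. Math. Stat. 6 (2018) 269–288, arXiv:1804.08851:
  Prop. 2.2, §2.3, Lemma 3.1, Lemma 3.2, Def. 4.1 and the paragraph following it, Lemma 4.2.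
  [GonzalezLiNguyen2018]
* C. Loewner, L. Nirenberg, *Partial differential equations invariant under conformal or
  projective transformations*, Contributions to Analysis, Academic Press (1974), 245–272.
  [LoewnerNirenberg1974]
-/

noncomputable section

open Set Filter Metric Module TopologicalSpace Bornology
open scoped Laplacian Topology ContDiff

namespace Literature.Analysis.PDE

namespace LoewnerNirenberg

variable {E : Type*} [NormedAddCommGroup E] [InnerProductSpace ℝ E] [FiniteDimensional ℝ E]

/-! ### Prop. 2.2: the comparison principle (classical case) -/

section Comparison

variable {U Ω : Set E} {v w : E → ℝ}

/-- **Comparison principle** (González–Li–Nguyen 2018, Prop. 2.2, for classical sub- and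
supersolutions of the Loewner–Nirenberg equation): let `n ≥ 3`, `U` bounded and open, `v ≥ 0` a
`C²` subsolution (`Δv ≥ f_n(v)`) and `w ≥ 0` a `C²` supersolution (`Δw ≤ f_n(w)`) on `U` with
`limsup_{x → z, x ∈ U} (v - w)(x) ≤ 0` at every `z ∈ ∂U`; then `v ≤ w` on `U` (otherwise `v - w`
has a positive interior maximum `x₁`, where `Δ(v - w)(x₁) ≤ 0 < f_n(v(x₁)) - f_n(w(x₁))`).
[cite: GonzalezLiNguyen2018, Prop. 2.2 (classical case)] -/
theorem comparison (hn : 3 ≤ finrank ℝ E) (hU : IsOpen U) (hb : IsBounded U)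
    (hv : IsSubsolution U v) (hw₂ : ContDiffOn ℝ 2 w U) (hw₀ : ∀ x ∈ U, 0 ≤ w x)
    (hwΔ : ∀ x ∈ U, (Δ w) x ≤ nonlinearity (finrank ℝ E) (w x))
    (hbdry : ∀ z ∈ frontier U, ∀ ε : ℝ, 0 < ε → ∀ᶠ x in 𝓝[U] z, v x < w x + ε) :
    ∀ x ∈ U, v x ≤ w x := by
  by_contra! H
  obtain ⟨x₀, hx₀, hlt⟩ := H
  -- the excess `g = v - w` and its superlevel set `K = {g ≥ δ}`, `δ = g x₀ > 0`
  set g : E → ℝ := v - w with hg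
  set δ : ℝ := v x₀ - w x₀ with hδ
  have hδ0 : 0 < δ := by rw [hδ]; linarith
  set K : Set E := {x | x ∈ U ∧ δ ≤ g x} with hK
  have hKU : K ⊆ U := fun x hx => hx.1
  have hgc : ContinuousOn g U := hv.contDiffOn.continuousOn.sub hw₂.continuousOn
  -- `K` is closed: limit points in `U` by continuity, limit points on `∂U` are excluded by `hbdry`
  have hKcl : IsClosed K := by
    refine isClosed_of_closure_subset fun z hz => ?_
    have hfreq : ∃ᶠ x in 𝓝 z, x ∈ K := mem_closure_iff_frequently.1 hz
    by_cases hzU : z ∈ U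
    · refine ⟨hzU, ?_⟩
      by_contra hlt'
      rw [not_le] at hlt'
      have hcz : ContinuousAt g z := hgc.continuousAt (hU.mem_nhds hzU)
      have hev : ∀ᶠ x in 𝓝 z, g x < δ := hcz.eventually_lt continuousAt_const hlt'
      obtain ⟨x, hxK, hxlt⟩ := (hfreq.and_eventually hev).exists
      exact absurd hxK.2 (not_le.2 hxlt)
    · exfalso
      have hzf : z ∈ frontier U := by
        rw [hU.frontier_eq]
        exact ⟨closure_mono hKU hz, hzU⟩
      have hev : ∀ᶠ x in 𝓝 z, x ∈ U → v x < w x + δ :=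
        eventually_nhdsWithin_iff.1 (hbdry z hzf δ hδ0)
      obtain ⟨x, hxK, hx⟩ := (hfreq.and_eventually hev).exists
      have h1 : δ ≤ v x - w x := hxK.2
      have h2 := hx hxK.1
      linarith
  have hKcpt : IsCompact K := Metric.isCompact_of_isClosed_isBounded hKcl (hb.subset hKU)
  have hx₀K : x₀ ∈ K := ⟨hx₀, by simp [hg, hδ]⟩
  -- a maximum point `x₁` of `g` on `K` is a local maximum of `g`
  obtain ⟨x₁, hx₁K, hmax⟩ := hKcpt.exists_isMaxOn ⟨x₀, hx₀K⟩ (hgc.mono hKU)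
  have hx₁U : x₁ ∈ U := hKU hx₁K
  have hloc : IsLocalMax g x₁ := by
    filter_upwards [hU.mem_nhds hx₁U] with y hy
    by_cases hyK : δ ≤ g y
    · exact hmax ⟨hy, hyK⟩
    · exact ((not_le.1 hyK).trans_le hx₁K.2).le
  -- the maximum principle at `x₁`
  have hvx : ContDiffAt ℝ 2 v x₁ := hv.contDiffOn.contDiffAt (hU.mem_nhds hx₁U)
  have hwx : ContDiffAt ℝ 2 w x₁ := hw₂.contDiffAt (hU.mem_nhds hx₁U)
  have hΔ : (Δ g) x₁ ≤ 0 := laplacian_nonpos_of_isLocalMax hloc (hvx.sub hwx)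
  rw [hg, hvx.laplacian_sub hwx] at hΔ
  -- but `Δv - Δw ≥ f(v) - f(w) > 0` at `x₁`, since `v x₁ > w x₁ ≥ 0`
  have hgx₁ : δ ≤ v x₁ - w x₁ := hx₁K.2
  have hvw : w x₁ < v x₁ := by linarith
  have hf := nonlinearity_lt_nonlinearity hn (hw₀ x₁ hx₁U) hvw
  have h1 := hv.le_laplacian hx₁U
  have h2 := hwΔ x₁ hx₁U
  linarith

/-- **A subsolution locally bounded above at `∂U` lies below every large solution of `U`**
(`U` bounded open, `n ≥ 3`; comparison with `w = ∞` on `∂U`, the way Prop. 2.2 is used in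
Lemma 3.1 and §4 of González–Li–Nguyen 2018). [cite: GonzalezLiNguyen2018, Prop. 2.2] -/
theorem IsLargeSolution.ge_of_isSubsolution (hn : 3 ≤ finrank ℝ E) (hU : IsOpen U)
    (hb : IsBounded U) (hw : IsLargeSolution U w) (hv : IsSubsolution U v)
    (hvb : ∀ z ∈ frontier U, ∃ M : ℝ, ∀ᶠ x in 𝓝[U] z, v x ≤ M) : ∀ x ∈ U, v x ≤ w x := by
  refine comparison hn hU hb hv hw.contDiffOn (fun x hx => hw.nonneg hx)
    (fun x hx => (hw.laplacian_eq hx).le) fun z hz ε hε => ?_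
  obtain ⟨M, hM⟩ := hvb z hz
  filter_upwards [hM, (hw.tendsto_atTop hz).eventually_gt_atTop M] with x h1 h2
  linarith

/-- **A solution on an open `Ω ⊇ Ū` lies below every large solution of `U`** (`U` bounded
open, `n ≥ 3`; González–Li–Nguyen 2018, §4: "By the comparison principle, `u_j` is
non-increasing", and the maximality mechanism of Def. 4.1). [cite: GonzalezLiNguyen2018, §4] -/
theorem IsLargeSolution.ge_of_isSolution (hn : 3 ≤ finrank ℝ E) (hU : IsOpen U)
    (hb : IsBounded U) (hw : IsLargeSolution U w) (hΩ : IsOpen Ω) (hUΩ : closure U ⊆ Ω)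
    (hv : IsSolution Ω v) : ∀ x ∈ U, v x ≤ w x := by
  refine hw.ge_of_isSubsolution hn hU hb
    (hv.mono (subset_closure.trans hUΩ)).isSubsolution fun z hz => ⟨v z + 1, ?_⟩
  have hzΩ : z ∈ Ω := hUΩ (frontier_subset_closure hz)
  have hcz : ContinuousAt v z := hv.contDiffOn.continuousOn.continuousAt (hΩ.mem_nhds hzΩ)
  exact ((hcz.eventually_lt continuousAt_const (lt_add_one (v z))).mono
    fun x hx => hx.le).filter_mono nhdsWithin_le_nhds

/-- **Large solutions of nested domains decrease** (González–Li–Nguyen 2018, §4: for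
`Ω₁ ⋐ Ω₂`, the large solutions satisfy `u₂ ≤ u₁` on `Ω₁`). [cite: GonzalezLiNguyen2018, §4] -/
theorem IsLargeSolution.antitone_of_closure_subset {Ω₁ Ω₂ : Set E} {u₁ u₂ : E → ℝ}
    (hn : 3 ≤ finrank ℝ E) (h₁ : IsOpen Ω₁) (hb : IsBounded Ω₁) (h₂ : IsOpen Ω₂)
    (hsub : closure Ω₁ ⊆ Ω₂) (hu₁ : IsLargeSolution Ω₁ u₁) (hu₂ : IsLargeSolution Ω₂ u₂) :
    ∀ x ∈ Ω₁, u₂ x ≤ u₁ x :=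
  hu₁.ge_of_isSolution hn h₁ hb h₂ hsub hu₂.toIsSolution

end Comparison

/-! ### Lemma 3.1: the upper bound `d(x)^{(n-2)/2} v(x) ≤ 2^{(n-2)/2}` -/

section UpperBound

variable {Ω : Set E} {v : E → ℝ} {x : E} {r : ℝ}

/-- **Lemma 3.1 (comparison with the ball solution)**: a subsolution on an open `Ω ⊇ B̄(c,r)`,
`r > 0`, `n ≥ 3`, lies below the Poincaré-ball solution `u^{(in)}_{r,c}` on `B(c,r)`.
[cite: GonzalezLiNguyen2018, Lemma 3.1] -/
theorem IsSubsolution.le_ballProfile (hn : 3 ≤ finrank ℝ E) (hΩ : IsOpen Ω)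
    (hv : IsSubsolution Ω v) {c : E} (hr : 0 < r) (hsub : closedBall c r ⊆ Ω) :
    ∀ y ∈ ball c r, v y ≤ ballProfile c r y := by
  refine (isLargeSolution_ballProfile hn c hr).ge_of_isSubsolution hn isOpen_ball isBounded_ball
    (hv.mono (ball_subset_closedBall.trans hsub)) fun z hz => ⟨v z + 1, ?_⟩
  have hzΩ : z ∈ Ω := by
    rw [frontier_ball c hr.ne'] at hz
    exact hsub (sphere_subset_closedBall hz)
  have hcz : ContinuousAt v z := hv.contDiffOn.continuousOn.continuousAt (hΩ.mem_nhds hzΩ)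
  exact ((hcz.eventually_lt continuousAt_const (lt_add_one (v z))).mono
    fun x hx => hx.le).filter_mono nhdsWithin_le_nhds

omit [FiniteDimensional ℝ E] in
/-- The value of the ball solution at the centre: `u^{(in)}_{r,c}(c) = (2/r)^{(n-2)/2}`.
[folklore] -/
theorem ballProfile_center (c : E) (hr : 0 < r) :
    ballProfile c r c = (2 / r) ^ (((finrank ℝ E : ℝ) - 2) / 2) := by
  simp only [ballProfile, sub_self, norm_zero]
  congr 1
  field_simp
  ring

/-- **Lemma 3.1 (pointwise form)**: a subsolution on an open `Ω ⊇ B̄(x,r)`, `r > 0`, `n ≥ 3`,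
satisfies `v(x) ≤ (2/r)^{(n-2)/2}` (`v(x) ≤ u^{(in)}_{R,x}(x) = α R^{-(n-2)/2}`, `α = 2^{(n-2)/2}`
in the Loewner–Nirenberg normalisation). [cite: GonzalezLiNguyen2018, Lemma 3.1] -/
theorem IsSubsolution.le_rpow_of_closedBall_subset (hn : 3 ≤ finrank ℝ E) (hΩ : IsOpen Ω)
    (hv : IsSubsolution Ω v) (hr : 0 < r) (hsub : closedBall x r ⊆ Ω) :
    v x ≤ (2 / r) ^ (((finrank ℝ E : ℝ) - 2) / 2) := by
  rw [← ballProfile_center x hr]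
  exact hv.le_ballProfile hn hΩ hr hsub x (mem_ball_self hr)

/-- **Lemma 3.1 (as printed)**: for a subsolution `v` on an open `Ω ≠ ℝⁿ`, `n ≥ 3`, and `x ∈ Ω`,
`v(x) ≤ (2/d(x))^{(n-2)/2}` with `d(x) = dist(x, ℝⁿ ∖ Ω) = dist(x, ∂Ω)`, i.e.
`d(x)^{(n-2)/2} v(x) ≤ 2^{(n-2)/2}` (González–Li–Nguyen 2018, Lemma 3.1, `α = 2^{(n-2)/2}`).
[cite: GonzalezLiNguyen2018, Lemma 3.1] -/
theorem IsSubsolution.le_rpow_infDist (hn : 3 ≤ finrank ℝ E) (hΩ : IsOpen Ω)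
    (hv : IsSubsolution Ω v) (hne : Ωᶜ.Nonempty) (hx : x ∈ Ω) :
    v x ≤ (2 / infDist x Ωᶜ) ^ (((finrank ℝ E : ℝ) - 2) / 2) := by
  set d : ℝ := infDist x Ωᶜ with hd
  have hd0 : 0 < d := (hΩ.isClosed_compl.notMem_iff_infDist_pos hne).1 (fun h => h hx)
  set k : ℝ := ((finrank ℝ E : ℝ) - 2) / 2 with hk
  -- `v x ≤ (2/ρ)^k` for every `0 < ρ < d`; let `ρ → d`
  have hle : ∀ ρ ∈ Ioo 0 d, v x ≤ (2 / ρ) ^ k := fun ρ hρ =>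
    hv.le_rpow_of_closedBall_subset hn hΩ hρ.1
      ((closedBall_subset_ball hρ.2).trans ball_infDist_compl_subset)
  have htend : Tendsto (fun ρ : ℝ => (2 / ρ) ^ k) (𝓝[<] d) (𝓝 ((2 / d) ^ k)) :=
    ((continuousAt_const.div continuousAt_id hd0.ne').rpow_const
      (Or.inl (div_pos two_pos hd0).ne')).tendsto.mono_left nhdsWithin_le_nhds
  refine ge_of_tendsto htend ?_
  filter_upwards [Ioo_mem_nhdsLT hd0] with ρ hρ using hle ρ hρ

/-- **The values of solutions at a point of an open set are bounded** (`n ≥ 3`; Lemma 3.1 on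
a closed ball inside `Ω`): `u_Ω(x)` is a genuine `sup`. [cite: GonzalezLiNguyen2018, Lemma 3.1] -/
theorem bddAbove_valuesAt_of_isOpen (hn : 3 ≤ finrank ℝ E) (hΩ : IsOpen Ω) (hx : x ∈ Ω) :
    BddAbove (valuesAt Ω x) := by
  obtain ⟨ε, hε, hball⟩ := Metric.isOpen_iff.1 hΩ x hx
  have hsub : closedBall x (ε / 2) ⊆ Ω := (closedBall_subset_ball (by linarith)).trans hball
  exact bddAbove_valuesAt fun w hw =>
    hw.isSubsolution.le_rpow_of_closedBall_subset hn hΩ (by linarith) hsub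

end UpperBound

/-! ### Unconditional consequences for `u_Ω` -/

section Consequences

variable {Ω Ω' : Set E} {v : E → ℝ} {x : E}

/-- **Every solution lies below `u_Ω`** on an open `Ω`, `n ≥ 3` (unconditional form of
`IsSolution.le_loewnerNirenberg'`). [cite: GonzalezLiNguyen2018, Lemma 3.1 and Def. 4.1] -/
theorem IsSolution.le_loewnerNirenberg_of_isOpen (hn : 3 ≤ finrank ℝ E) (hΩ : IsOpen Ω)
    (hv : IsSolution Ω v) (hx : x ∈ Ω) : v x ≤ loewnerNirenberg Ω x :=
  hv.le_loewnerNirenberg hx (bddAbove_valuesAt_of_isOpen hn hΩ hx)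

/-- **Antitonicity of `Ω ↦ u_Ω`** (unconditional form of `loewnerNirenberg_antitone`): for
`Ω ⊆ Ω'`, `Ω` open, `n ≥ 3`, `u_Ω' ≤ u_Ω` on `Ω` (González–Li–Nguyen 2018, after Def. 4.1: "if
`Ω ⊂ Ω̃`, then `u_Ω ≥ u_Ω̃` in `Ω`"). [cite: GonzalezLiNguyen2018, §4 after Def. 4.1] -/
theorem loewnerNirenberg_antitone_of_isOpen (hn : 3 ≤ finrank ℝ E) (hΩ : IsOpen Ω) (h : Ω ⊆ Ω')
    (hx : x ∈ Ω) : loewnerNirenberg Ω' x ≤ loewnerNirenberg Ω x :=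
  loewnerNirenberg_anti h hx (bddAbove_valuesAt_of_isOpen hn hΩ hx)

/-- **Lemma 3.1 for `u_Ω`**: `u_Ω(x) ≤ (2/r)^{(n-2)/2}` whenever `B̄(x,r) ⊆ Ω`, `Ω` open, `r > 0`,
`n ≥ 3`. [cite: GonzalezLiNguyen2018, Lemma 3.1] -/
theorem loewnerNirenberg_le_rpow_of_closedBall_subset (hn : 3 ≤ finrank ℝ E) (hΩ : IsOpen Ω)
    {r : ℝ} (hr : 0 < r) (hsub : closedBall x r ⊆ Ω) :
    loewnerNirenberg Ω x ≤ (2 / r) ^ (((finrank ℝ E : ℝ) - 2) / 2) :=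
  loewnerNirenberg_le fun _ hw => hw.isSubsolution.le_rpow_of_closedBall_subset hn hΩ hr hsub

/-- **Lemma 3.1 for `u_Ω` (as printed)**: `u_Ω(x) ≤ (2/d(x))^{(n-2)/2}`, `d(x) = dist(x, ℝⁿ ∖ Ω)`,
for `Ω ≠ ℝⁿ` open, `x ∈ Ω`, `n ≥ 3`. [cite: GonzalezLiNguyen2018, Lemma 3.1] -/
theorem loewnerNirenberg_le_rpow_infDist (hn : 3 ≤ finrank ℝ E) (hΩ : IsOpen Ω)
    (hne : Ωᶜ.Nonempty) (hx : x ∈ Ω) :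
    loewnerNirenberg Ω x ≤ (2 / infDist x Ωᶜ) ^ (((finrank ℝ E : ℝ) - 2) / 2) :=
  loewnerNirenberg_le fun _ hw => hw.isSubsolution.le_rpow_infDist hn hΩ hne hx

/-- **`u_Ω ≤ u_j` on `Ω_j ⋐ Ω`** (González–Li–Nguyen 2018, Def. 4.1: `u_Ω` lies below the large
solution of every bounded open `U` with `Ū ⊆ Ω`; every solution on `Ω` does, by comparison).
[cite: GonzalezLiNguyen2018, Def. 4.1] -/
theorem loewnerNirenberg_le_of_isLargeSolution {U : Set E} {w : E → ℝ} (hn : 3 ≤ finrank ℝ E)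
    (hU : IsOpen U) (hb : IsBounded U) (hw : IsLargeSolution U w) (hΩ : IsOpen Ω)
    (hUΩ : closure U ⊆ Ω) (hx : x ∈ U) : loewnerNirenberg Ω x ≤ w x :=
  loewnerNirenberg_le fun _ hv => hw.ge_of_isSolution hn hU hb hΩ hUΩ hv x hx

/-- **Lemma 3.2 for `u_Ω`**: if `Ω` is open, `n ≥ 3`, and `Ω ⊆ ℝⁿ ∖ B̄(c,R)`, `R > 0`, then
`u^{(out)}_{R,c} ≤ u_Ω` on `Ω` (the exterior-ball solution restricts to a solution on `Ω`;
González–Li–Nguyen 2018, Lemma 3.2 and the proof of Lemma 4.2).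
[cite: GonzalezLiNguyen2018, Lemma 3.2] -/
theorem exteriorProfile_le_loewnerNirenberg_of_subset (hn : 3 ≤ finrank ℝ E) (hΩ : IsOpen Ω)
    {c : E} {R : ℝ} (hR : 0 < R) (hsub : Ω ⊆ (closedBall c R)ᶜ) (hx : x ∈ Ω) :
    exteriorProfile c R x ≤ loewnerNirenberg Ω x :=
  ((isSolution_exteriorProfile c hR).mono hsub).le_loewnerNirenberg_of_isOpen hn hΩ hx

/-- **`u_Ω > 0` when `ℝⁿ ∖ Ω̄ ≠ ∅`** — the positivity half of F1, unconditionally: for `Ω` open,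
`n ≥ 3`, `(closure Ω)ᶜ ≠ ∅` and `x ∈ Ω`, `0 < u_Ω(x)` (a closed ball `B̄(c,R) ⊆ ℝⁿ ∖ Ω̄` gives the
positive solution `u^{(out)}_{R,c} ≤ u_Ω` on `Ω`; "`u_Ω > 0` (which is the case if e.g.
`ℝⁿ ∖ Ω̄ ≠ ∅`; see Lemma 3.2)"). [cite: GonzalezLiNguyen2018, §4 after Def. 4.1 (Lemma 3.2)] -/
theorem loewnerNirenberg_pos_of_isOpen (hn : 3 ≤ finrank ℝ E) (hΩ : IsOpen Ω)
    (hc : (closure Ω)ᶜ.Nonempty) (hx : x ∈ Ω) : 0 < loewnerNirenberg Ω x := by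
  obtain ⟨c, hc⟩ := hc
  obtain ⟨ε, hε, hball⟩ := Metric.isOpen_iff.1 isClosed_closure.isOpen_compl c hc
  have hR : 0 < ε / 2 := by linarith
  have hsub : Ω ⊆ (closedBall c (ε / 2))ᶜ := by
    intro y hy hy'
    exact hball (closedBall_subset_ball (by linarith) hy') (subset_closure hy)
  exact (exteriorProfile_pos hR (hsub hx)).trans_le
    (exteriorProfile_le_loewnerNirenberg_of_subset hn hΩ hR hsub hx)

end Consequences

/-! ### Def. 4.1: maximality of `u_Ω`, and the reduction of F1 to the solution property -/

section Maximal

variable {Ω : Set E} {x : E}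

/-- **Once `u_Ω` solves the equation it is the maximal solution** (`n ≥ 3`, `Ω` open): every
solution lies below `u_Ω` by Lemma 3.1 (González–Li–Nguyen 2018, after Def. 4.1: "it is the
maximal positive solution"). [cite: GonzalezLiNguyen2018, §4 after Def. 4.1] -/
theorem isMaximalSolution_loewnerNirenberg_of_isSolution (hn : 3 ≤ finrank ℝ E) (hΩ : IsOpen Ω)
    (h : IsSolution Ω (loewnerNirenberg Ω)) : IsMaximalSolution Ω (loewnerNirenberg Ω) where
  toIsSolution := h
  le := fun _ hv _ hx => hv.le_loewnerNirenberg_of_isOpen hn hΩ hx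

/-- **Reduction of F1**: `exists_isMaximalSolution` follows from (indeed is equivalent to,
`exists_isMaximalSolution_iff`) "`u_Ω` solves the Loewner–Nirenberg equation on every domain `Ω`
with `ℝⁿ ∖ Ω̄ ≠ ∅`", positivity and maximality being settled above; what remains is the passage
to the limit `u_Ω = lim u_j` of Def. 4.1. [cite: GonzalezLiNguyen2018, Def. 4.1] -/
theorem exists_isMaximalSolution_of_isSolution
    (h : ∀ ⦃Ω : Set E⦄, 3 ≤ finrank ℝ E → IsOpen Ω → IsConnected Ω → (closure Ω)ᶜ.Nonempty →
      IsSolution Ω (loewnerNirenberg Ω)) :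
    exists_isMaximalSolution (E := E) := fun _ hn hΩ hconn hc =>
  ⟨_, isMaximalSolution_loewnerNirenberg_of_isSolution hn hΩ (h hn hΩ hconn hc), fun _ hx =>
    loewnerNirenberg_pos_of_isOpen hn hΩ hc hx⟩

/-- **F1 ⇔ `u_Ω` solves the equation** on every domain with `ℝⁿ ∖ Ω̄ ≠ ∅` (`n ≥ 3`).
[cite: GonzalezLiNguyen2018, Def. 4.1] -/
theorem exists_isMaximalSolution_iff :
    exists_isMaximalSolution (E := E) ↔
      ∀ ⦃Ω : Set E⦄, 3 ≤ finrank ℝ E → IsOpen Ω → IsConnected Ω → (closure Ω)ᶜ.Nonempty →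
        IsSolution Ω (loewnerNirenberg Ω) :=
  ⟨fun h _ hn hΩ hconn hc => (isMaximalSolution_loewnerNirenberg h hn hΩ hconn hc).toIsSolution,
    exists_isMaximalSolution_of_isSolution⟩

/-- **The exhaustion construction `u_Ω = lim u_j`** (González–Li–Nguyen 2018, Def. 4.1), closed
modulo existence of the large solutions and regularity of the limit: `n ≥ 3`, `Ω` open, `Ω_j`
bounded open with `Ω̄_j ⊆ Ω` carrying large solutions `u_j`, every point of `Ω` lying in `Ω_j`
for all large `j`; if `u_j → u` pointwise on `Ω` for a SOLUTION `u` on `Ω`, then `u = u_Ω` on `Ω`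
(`u ≤ u_Ω` as a solution; `u_Ω ≤ u_j` on `Ω_j`). [cite: GonzalezLiNguyen2018, Def. 4.1] -/
theorem eqOn_loewnerNirenberg_of_exhaustion (hn : 3 ≤ finrank ℝ E) (hΩ : IsOpen Ω)
    {U : ℕ → Set E} {w : ℕ → E → ℝ} (hUo : ∀ j, IsOpen (U j)) (hUb : ∀ j, IsBounded (U j))
    (hUΩ : ∀ j, closure (U j) ⊆ Ω) (hw : ∀ j, IsLargeSolution (U j) (w j))
    (hexh : ∀ x ∈ Ω, ∀ᶠ j in atTop, x ∈ U j) {u : E → ℝ} (hu : IsSolution Ω u)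
    (hlim : ∀ x ∈ Ω, Tendsto (fun j => w j x) atTop (𝓝 (u x))) :
    EqOn u (loewnerNirenberg Ω) Ω := fun x hx =>
  le_antisymm (hu.le_loewnerNirenberg_of_isOpen hn hΩ hx) <|
    ge_of_tendsto (hlim x hx) ((hexh x hx).mono fun j hj =>
      loewnerNirenberg_le_of_isLargeSolution hn (hUo j) (hUb j) (hw j) hΩ (hUΩ j) hj)

end Maximal

end LoewnerNirenberg

end Literature.Analysis.PDE
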